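import Summits.Ventures.PercRepro.Night2T3LinesB

/-!
# PercRepro — corank `7`, `q = 4`, `m(G) = 0`: parts L6+T (night-2 gen 3, NIGHT-2-profile.md §3d)
The facts of the cyclic-rank profile (P1)–(P3), the line facts (L1)–(L5) and the weighted rises (L4), instantiated in `ℚ`,
and the exact dual certificate of the profile LP (`leanlp_c7.py`) checked by `linear_combination`.
-/
namespace PercRepro.Star

open Finset ThmH SixFour GenQ

variable {α : Type*} [DecidableEq α] {M : Matroid α} [M.Finite]
/-- Level `6` facts, `q = 4`, `m(G) = 0`, corank `7`. -/
theorem c7_q4_m0_k6 (hs : Simple M) {G : Finset α} (hG : G ⊆ gr M) (hrG : M.eRk (G : Set α) = ((4 : ℕ) : ℕ∞)) (hcard : G.card = 4 + 7) (hmG : mTr M G = 0) :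
    (5 : ℚ) * ((Pc M G 4 6 0).card : ℚ) = (mv M G 4 6 0 0 : ℚ) + (mv M G 4 6 1 0 : ℚ) + (mv M G 4 6 2 0 : ℚ) + (mv M G 4 6 3 0 : ℚ) + (mv M G 4 6 4 0 : ℚ) ∧
    (4 : ℚ) * ((Pc M G 4 6 1).card : ℚ) = (mv M G 4 6 1 1 : ℚ) + (mv M G 4 6 2 1 : ℚ) + (mv M G 4 6 3 1 : ℚ) + (mv M G 4 6 4 1 : ℚ) ∧
    (3 : ℚ) * ((Pc M G 4 6 2).card : ℚ) = (mv M G 4 6 2 2 : ℚ) + (mv M G 4 6 3 2 : ℚ) + (mv M G 4 6 4 2 : ℚ) ∧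
    (2 : ℚ) * ((Pc M G 4 6 3).card : ℚ) = (mv M G 4 6 3 3 : ℚ) + (mv M G 4 6 4 3 : ℚ) ∧
    (1 : ℚ) * ((Pc M G 4 6 4).card : ℚ) = (mv M G 4 6 4 4 : ℚ) ∧
    (7 : ℚ) * ((Pc M G 4 7 0).card : ℚ) = (mv M G 4 6 0 0 : ℚ) ∧
    (7 : ℚ) * ((Pc M G 4 7 1).card : ℚ) = (mv M G 4 6 1 0 : ℚ) + (mv M G 4 6 1 1 : ℚ) ∧
    (7 : ℚ) * ((Pc M G 4 7 2).card : ℚ) = (mv M G 4 6 2 0 : ℚ) + (mv M G 4 6 2 1 : ℚ) + (mv M G 4 6 2 2 : ℚ) ∧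
    (7 : ℚ) * ((Pc M G 4 7 3).card : ℚ) = (mv M G 4 6 3 0 : ℚ) + (mv M G 4 6 3 1 : ℚ) + (mv M G 4 6 3 2 : ℚ) + (mv M G 4 6 3 3 : ℚ) ∧
    (7 : ℚ) * ((Pc M G 4 7 4).card : ℚ) = (mv M G 4 6 4 0 : ℚ) + (mv M G 4 6 4 1 : ℚ) + (mv M G 4 6 4 2 : ℚ) + (mv M G 4 6 4 3 : ℚ) + (mv M G 4 6 4 4 : ℚ) ∧
    (mv M G 4 6 1 1 : ℚ) ≤ (6 : ℚ) * ((Pc M G 4 7 1).card : ℚ) ∧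
    (mv M G 4 6 2 2 : ℚ) ≤ (6 : ℚ) * ((Pc M G 4 7 2).card : ℚ) ∧
    (mv M G 4 6 3 3 : ℚ) ≤ (6 : ℚ) * ((Pc M G 4 7 3).card : ℚ) ∧
    (mv M G 4 6 4 4 : ℚ) ≤ (6 : ℚ) * ((Pc M G 4 7 4).card : ℚ) ∧
    (mv M G 4 6 0 0 : ℚ) = (7 : ℚ) * ((Pc M G 4 7 0).card : ℚ) ∧
    ((Pc M G 4 6 3).card : ℚ) = 0 ∧
    ((Pc M G 4 6 4).card : ℚ) = 0 ∧
    ((Pc M G 4 6 2).card : ℚ) = (1 : ℚ) * (Bl M G 4 3 : ℚ) + (4 : ℚ) * (Bl M G 4 4 : ℚ) + (10 : ℚ) * (Bl M G 4 5 : ℚ) + (20 : ℚ) * (Bl M G 4 6 : ℚ) + (35 : ℚ) * (Bl M G 4 7 : ℚ) + (56 : ℚ) * (Bl M G 4 8 : ℚ) + (84 : ℚ) * (Bl M G 4 9 : ℚ) + (120 : ℚ) * (Bl M G 4 10 : ℚ) + (165 : ℚ) * (Bl M G 4 11 : ℚ) ∧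
    (1 : ℚ) * ((Pc M G 4 7 1).card : ℚ) ≤ (1 : ℚ) * (mv M G 4 6 1 0 : ℚ) + (0 : ℚ) * (mv M G 4 6 1 1 : ℚ) ∧
    (2 : ℚ) * ((Pc M G 4 7 2).card : ℚ) ≤ (2 : ℚ) * (mv M G 4 6 2 0 : ℚ) + (1 : ℚ) * (mv M G 4 6 2 1 : ℚ) + (0 : ℚ) * (mv M G 4 6 2 2 : ℚ) ∧
    (3 : ℚ) * ((Pc M G 4 7 3).card : ℚ) ≤ (3 : ℚ) * (mv M G 4 6 3 0 : ℚ) + (2 : ℚ) * (mv M G 4 6 3 1 : ℚ) + (1 : ℚ) * (mv M G 4 6 3 2 : ℚ) + (0 : ℚ) * (mv M G 4 6 3 3 : ℚ) ∧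
    (4 : ℚ) * ((Pc M G 4 7 4).card : ℚ) ≤ (4 : ℚ) * (mv M G 4 6 4 0 : ℚ) + (3 : ℚ) * (mv M G 4 6 4 1 : ℚ) + (2 : ℚ) * (mv M G 4 6 4 2 : ℚ) + (1 : ℚ) * (mv M G 4 6 4 3 : ℚ) + (0 : ℚ) * (mv M G 4 6 4 4 : ℚ) := by
  have e_0_0 : Finset.Icc (0 : ℕ) 0 = {0} := by
    ext x; simp only [Finset.mem_Icc, Finset.mem_singleton]; omega
  have e_0_1 : Finset.Icc (0 : ℕ) 1 = {0, 1} := by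
    ext x; simp only [Finset.mem_Icc, Finset.mem_insert, Finset.mem_singleton]; omega
  have e_0_2 : Finset.Icc (0 : ℕ) 2 = {0, 1, 2} := by
    ext x; simp only [Finset.mem_Icc, Finset.mem_insert, Finset.mem_singleton]; omega
  have e_0_3 : Finset.Icc (0 : ℕ) 3 = {0, 1, 2, 3} := by
    ext x; simp only [Finset.mem_Icc, Finset.mem_insert, Finset.mem_singleton]; omega
  have e_0_4 : Finset.Icc (0 : ℕ) 4 = {0, 1, 2, 3, 4} := by
    ext x; simp only [Finset.mem_Icc, Finset.mem_insert, Finset.mem_singleton]; omega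
  have e_1_4 : Finset.Icc (1 : ℕ) 4 = {1, 2, 3, 4} := by
    ext x; simp only [Finset.mem_Icc, Finset.mem_insert, Finset.mem_singleton]; omega
  have e_2_4 : Finset.Icc (2 : ℕ) 4 = {2, 3, 4} := by
    ext x; simp only [Finset.mem_Icc, Finset.mem_insert, Finset.mem_singleton]; omega
  have e_3_4 : Finset.Icc (3 : ℕ) 4 = {3, 4} := by
    ext x; simp only [Finset.mem_Icc, Finset.mem_insert, Finset.mem_singleton]; omega
  have e_4_4 : Finset.Icc (4 : ℕ) 4 = {4} := by
    ext x; simp only [Finset.mem_Icc, Finset.mem_singleton]; omega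
  have hr : ∀ f : ℕ → ℕ, ∑ l ∈ Finset.range (4 + 7 + 1), f l = f 0 + f 1 + f 2 + f 3 + f 4 + f 5 + f 6 + f 7 + f 8 + f 9 + f 10 + f 11 := by
    intro f; simp only [Finset.sum_range_succ, Finset.sum_range_zero, Nat.zero_add]
  have ch_0_2 : Nat.choose 0 2 = 0 := by decide
  have ch_1_2 : Nat.choose 1 2 = 0 := by decide
  have ch_2_2 : Nat.choose 2 2 = 1 := by decide
  have ch_3_2 : Nat.choose 3 2 = 3 := by decide
  have ch_4_2 : Nat.choose 4 2 = 6 := by decide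
  have ch_5_2 : Nat.choose 5 2 = 10 := by decide
  have ch_6_2 : Nat.choose 6 2 = 15 := by decide
  have ch_7_2 : Nat.choose 7 2 = 21 := by decide
  have ch_8_2 : Nat.choose 8 2 = 28 := by decide
  have ch_9_2 : Nat.choose 9 2 = 36 := by decide
  have ch_10_2 : Nat.choose 10 2 = 45 := by decide
  have ch_11_2 : Nat.choose 11 2 = 55 := by decide
  have ch_0_3 : Nat.choose 0 3 = 0 := by decide
  have ch_1_3 : Nat.choose 1 3 = 0 := by decide
  have ch_2_3 : Nat.choose 2 3 = 0 := by decide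
  have ch_3_3 : Nat.choose 3 3 = 1 := by decide
  have ch_4_3 : Nat.choose 4 3 = 4 := by decide
  have ch_5_3 : Nat.choose 5 3 = 10 := by decide
  have ch_6_3 : Nat.choose 6 3 = 20 := by decide
  have ch_7_3 : Nat.choose 7 3 = 35 := by decide
  have ch_8_3 : Nat.choose 8 3 = 56 := by decide
  have ch_9_3 : Nat.choose 9 3 = 84 := by decide
  have ch_10_3 : Nat.choose 10 3 = 120 := by decide
  have ch_11_3 : Nat.choose 11 3 = 165 := by decide
  refine ⟨?_, ?_, ?_, ?_, ?_, ?_, ?_, ?_, ?_, ?_, ?_, ?_, ?_, ?_, ?_, ?_, ?_, ?_, ?_, ?_, ?_, ?_⟩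
  · have h := card_mul_card_Pc_eq_sum_mv hG hrG 6 0; rw [hcard, e_0_4, Finset.sum_insert (by simp), Finset.sum_insert (by simp), Finset.sum_insert (by simp), Finset.sum_insert (by simp), Finset.sum_singleton] at h; have hq := congrArg (fun z : ℕ => (z : ℚ)) h; push_cast at hq; linear_combination hq
  · have h := card_mul_card_Pc_eq_sum_mv hG hrG 6 1; rw [hcard, e_1_4, Finset.sum_insert (by simp), Finset.sum_insert (by simp), Finset.sum_insert (by simp), Finset.sum_singleton] at h; have hq := congrArg (fun z : ℕ => (z : ℚ)) h; push_cast at hq; linear_combination hq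
  · have h := card_mul_card_Pc_eq_sum_mv hG hrG 6 2; rw [hcard, e_2_4, Finset.sum_insert (by simp), Finset.sum_insert (by simp), Finset.sum_singleton] at h; have hq := congrArg (fun z : ℕ => (z : ℚ)) h; push_cast at hq; linear_combination hq
  · have h := card_mul_card_Pc_eq_sum_mv hG hrG 6 3; rw [hcard, e_3_4, Finset.sum_insert (by simp), Finset.sum_singleton] at h; have hq := congrArg (fun z : ℕ => (z : ℚ)) h; push_cast at hq; linear_combination hq
  · have h := card_mul_card_Pc_eq_sum_mv hG hrG 6 4; rw [hcard, e_4_4, Finset.sum_singleton] at h; have hq := congrArg (fun z : ℕ => (z : ℚ)) h; push_cast at hq; linear_combination hq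
  · have h := (hmG ▸ succ_mul_card_Pc_eq_sum_mv hG hrG 6 0); rw [e_0_0, Finset.sum_singleton] at h; have hq := congrArg (fun z : ℕ => (z : ℚ)) h; push_cast at hq; linear_combination hq
  · have h := (hmG ▸ succ_mul_card_Pc_eq_sum_mv hG hrG 6 1); rw [e_0_1, Finset.sum_insert (by simp), Finset.sum_singleton] at h; have hq := congrArg (fun z : ℕ => (z : ℚ)) h; push_cast at hq; linear_combination hq
  · have h := (hmG ▸ succ_mul_card_Pc_eq_sum_mv hG hrG 6 2); rw [e_0_2, Finset.sum_insert (by simp), Finset.sum_insert (by simp), Finset.sum_singleton] at h; have hq := congrArg (fun z : ℕ => (z : ℚ)) h; push_cast at hq; linear_combination hq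
  · have h := (hmG ▸ succ_mul_card_Pc_eq_sum_mv hG hrG 6 3); rw [e_0_3, Finset.sum_insert (by simp), Finset.sum_insert (by simp), Finset.sum_insert (by simp), Finset.sum_singleton] at h; have hq := congrArg (fun z : ℕ => (z : ℚ)) h; push_cast at hq; linear_combination hq
  · have h := (hmG ▸ succ_mul_card_Pc_eq_sum_mv hG hrG 6 4); rw [e_0_4, Finset.sum_insert (by simp), Finset.sum_insert (by simp), Finset.sum_insert (by simp), Finset.sum_insert (by simp), Finset.sum_singleton] at h; have hq := congrArg (fun z : ℕ => (z : ℚ)) h; push_cast at hq; linear_combination hq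
  · have h := mv_self_le hG hrG 6 (m := 1) (by rw [hmG]; norm_num); have hq := (Nat.cast_le (α := ℚ)).mpr h; push_cast at hq; linear_combination hq
  · have h := mv_self_le hG hrG 6 (m := 2) (by rw [hmG]; norm_num); have hq := (Nat.cast_le (α := ℚ)).mpr h; push_cast at hq; linear_combination hq
  · have h := mv_self_le hG hrG 6 (m := 3) (by rw [hmG]; norm_num); have hq := (Nat.cast_le (α := ℚ)).mpr h; push_cast at hq; linear_combination hq
  · have h := mv_self_le hG hrG 6 (m := 4) (by rw [hmG]; norm_num); have hq := (Nat.cast_le (α := ℚ)).mpr h; push_cast at hq; linear_combination hq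
  · have h := (hmG ▸ mv_self_eq hG hrG 6); have hq := congrArg (fun z : ℕ => (z : ℚ)) h; push_cast at hq; linear_combination hq
  · have h := card_Pc_eq_zero_of_nonbasis hs hG (by norm_num) hcard (k := 6) (m := 3) (by norm_num) (by norm_num); exact_mod_cast h
  · have h := card_Pc_eq_zero_of_nonbasis hs hG (by norm_num) hcard (k := 6) (m := 4) (by norm_num) (by norm_num); exact_mod_cast h
  · have h := card_Pc_sub_two_eq hs hG hrG (by norm_num) hcard (k := 6) (by norm_num); rw [sum_lines_mul_betaL_eq (f := fun l => l.choose (7 - 6 + 2)), hcard, hr] at h; simp only [Nat.reduceSub, Nat.reduceAdd, ch_0_3, ch_1_3, ch_2_3, ch_3_3, ch_4_3, ch_5_3, ch_6_3, ch_7_3, ch_8_3, ch_9_3, ch_10_3, ch_11_3] at h; have hq := congrArg (fun z : ℕ => (z : ℚ)) h; push_cast at hq; linear_combination hq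
  · have h := weighted_rises hG hrG (q := 4) (k := 6) (m' := 1); rw [hmG, e_0_1, Finset.sum_insert (by simp), Finset.sum_singleton] at h; have hq := (Int.cast_le (R := ℚ)).mpr h; push_cast at hq; linear_combination hq
  · have h := weighted_rises hG hrG (q := 4) (k := 6) (m' := 2); rw [hmG, e_0_2, Finset.sum_insert (by simp), Finset.sum_insert (by simp), Finset.sum_singleton] at h; have hq := (Int.cast_le (R := ℚ)).mpr h; push_cast at hq; linear_combination hq
  · have h := weighted_rises hG hrG (q := 4) (k := 6) (m' := 3); rw [hmG, e_0_3, Finset.sum_insert (by simp), Finset.sum_insert (by simp), Finset.sum_insert (by simp), Finset.sum_singleton] at h; have hq := (Int.cast_le (R := ℚ)).mpr h; push_cast at hq; linear_combination hq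
  · have h := weighted_rises hG hrG (q := 4) (k := 6) (m' := 4); rw [hmG, e_0_4, Finset.sum_insert (by simp), Finset.sum_insert (by simp), Finset.sum_insert (by simp), Finset.sum_insert (by simp), Finset.sum_singleton] at h; have hq := (Int.cast_le (R := ℚ)).mpr h; push_cast at hq; linear_combination hq

/-- The partial certificate of level `6`: `0 ≤ R`. -/
theorem c7_q4_m0_cert_6 (hs : Simple M) {G : Finset α} (hG : G ⊆ gr M) (hrG : M.eRk (G : Set α) = ((4 : ℕ) : ℕ∞)) (hcard : G.card = 4 + 7) (hmG : mTr M G = 0) : 0 ≤ (4853 / 329 : ℚ) * ((Pc M G 4 6 0).card : ℚ) + (4771 / 658 : ℚ) * ((Pc M G 4 6 1).card : ℚ) + (1563 / 329 : ℚ) * ((Pc M G 4 6 2).card : ℚ) + (4607 / 1316 : ℚ) * ((Pc M G 4 6 3).card : ℚ) + (905 / 329 : ℚ) * ((Pc M G 4 6 4).card : ℚ) + (-3 : ℚ) * ((Pc M G 4 7 0).card : ℚ) + (-3 : ℚ) * ((Pc M G 4 7 1).card : ℚ) + (-3 : ℚ) * ((Pc M G 4 7 2).card : ℚ) + (-3 :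 ℚ) * ((Pc M G 4 7 3).card : ℚ) + (-3 : ℚ) * ((Pc M G 4 7 4).card : ℚ) + (-1140 / 329 : ℚ) * (Bl M G 4 3 : ℚ) + (-4560 / 329 : ℚ) * (Bl M G 4 4 : ℚ) + (-11400 / 329 : ℚ) * (Bl M G 4 5 : ℚ) + (-22800 / 329 : ℚ) * (Bl M G 4 6 : ℚ) + (-5700 / 47 : ℚ) * (Bl M G 4 7 : ℚ) + (-9120 / 47 : ℚ) * (Bl M G 4 8 : ℚ) + (-13680 / 47 : ℚ) * (Bl M G 4 9 : ℚ) + (-136800 / 329 : ℚ) * (Bl M G 4 10 : ℚ) + (-188100 / 329 : ℚ) * (Bl M G 4 11 : ℚ) := by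
  have hk6 := c7_q4_m0_k6 hs hG hrG hcard hmG
  linear_combination (-3 / 7 : ℚ) * hk6.1 + (-3 / 7 : ℚ) * hk6.2.1 + (-3 / 7 : ℚ) * hk6.2.2.1 + (-3 / 7 : ℚ) * hk6.2.2.2.1 + (-3 / 7 : ℚ) * hk6.2.2.2.2.1 + (3 / 7 : ℚ) * hk6.2.2.2.2.2.1 + (3 / 7 : ℚ) * hk6.2.2.2.2.2.2.1 + (3 / 7 : ℚ) * hk6.2.2.2.2.2.2.2.1 + (3 / 7 : ℚ) * hk6.2.2.2.2.2.2.2.2.1 + (3 / 7 : ℚ) * hk6.2.2.2.2.2.2.2.2.2.1 + (-497 / 188 : ℚ) * hk6.2.2.2.2.2.2.2.2.2.2.2.2.2.2.2.1 + (-764 / 329 : ℚ) * hk6.2.2.2.2.2.2.2.2.2.2.2.2.2.2.2.2.1 + (-1140 / 329 : ℚ) * hk6.2.2.2.2.2.2.2.2.2.2.2.2.2.2.2.2.2.1 + (4148 / 329 : ℚ) * (Nat.cast_nonneg _ : (0 : ℚ) ≤ ((Pc M G 4 6 0).card : ℚ)) + (3643 / 658 : ℚ) * (Nat.cast_nonneg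 _ : (0 : ℚ) ≤ ((Pc M G 4 6 1).card : ℚ))
/-- Level `0`, the bases, the demand-free levels with the line subsets, and `B_ℓ ≤ C(n−ℓ, q−2)·N_ℓ`. -/
theorem c7_q4_m0_top (hs : Simple M) {G : Finset α} (hG : G ⊆ gr M) (hrG : M.eRk (G : Set α) = ((4 : ℕ) : ℕ∞)) (hcard : G.card = 4 + 7) (hmG : mTr M G = 0) :
    ((Pc M G 4 0 0).card : ℚ) = 1 ∧
    ((Pc M G 4 0 1).card : ℚ) = 0 ∧
    ((Pc M G 4 0 2).card : ℚ) = 0 ∧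
    ((Pc M G 4 0 3).card : ℚ) = 0 ∧
    ((Pc M G 4 0 4).card : ℚ) = 0 ∧
    ((Pc M G 4 7 0).card : ℚ) = 0 ∧
    ((Pc M G 4 7 1).card : ℚ) = 0 ∧
    ((Pc M G 4 7 2).card : ℚ) = 0 ∧
    ((Pc M G 4 7 3).card : ℚ) = 0 ∧
    ((Pc M G 4 0 0).card : ℚ) + ((Pc M G 4 0 1).card : ℚ) + ((Pc M G 4 0 2).card : ℚ) + ((Pc M G 4 0 3).card : ℚ) + ((Pc M G 4 0 4).card : ℚ) + ((Pc M G 4 1 0).card : ℚ) + ((Pc M G 4 1 1).card : ℚ) + ((Pc M G 4 1 2).card : ℚ) + ((Pc M G 4 1 3).card : ℚ) + ((Pc M G 4 1 4).card : ℚ) + ((Pc M G 4 2 0).card : ℚ) + ((Pc M G 4 2 1).card : ℚ) + ((Pc M G 4 2 2).card : ℚ) + ((Pc M G 4 2 3).card : ℚ) + ((Pc M G 4 2 4).card : ℚ) + (10 : ℚ) * (Nl M G 5 : ℚ) + (35 : ℚ) * (Nl M G 6 : ℚ) + (91 : ℚ) * (Nl M G 7 : ℚ) + (210 : ℚ) *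 (Nl M G 8 : ℚ) + (456 : ℚ) * (Nl M G 9 : ℚ) + (957 : ℚ) * (Nl M G 10 : ℚ) + (1969 : ℚ) * (Nl M G 11 : ℚ) ≤ (DFq M G 4 3 : ℚ) ∧
    (Bl M G 4 0 : ℚ) ≤ (55 : ℚ) * (Nl M G 0 : ℚ) ∧
    (Bl M G 4 1 : ℚ) ≤ (45 : ℚ) * (Nl M G 1 : ℚ) ∧
    (Bl M G 4 2 : ℚ) ≤ (36 : ℚ) * (Nl M G 2 : ℚ) ∧
    (Bl M G 4 3 : ℚ) ≤ (28 : ℚ) * (Nl M G 3 : ℚ) ∧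
    (Bl M G 4 4 : ℚ) ≤ (21 : ℚ) * (Nl M G 4 : ℚ) ∧
    (Bl M G 4 5 : ℚ) ≤ (15 : ℚ) * (Nl M G 5 : ℚ) ∧
    (Bl M G 4 6 : ℚ) ≤ (10 : ℚ) * (Nl M G 6 : ℚ) ∧
    (Bl M G 4 7 : ℚ) ≤ (6 : ℚ) * (Nl M G 7 : ℚ) ∧
    (Bl M G 4 8 : ℚ) ≤ (3 : ℚ) * (Nl M G 8 : ℚ) ∧
    (Bl M G 4 9 : ℚ) ≤ (1 : ℚ) * (Nl M G 9 : ℚ) ∧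
    (Bl M G 4 10 : ℚ) ≤ (0 : ℚ) * (Nl M G 10 : ℚ) ∧
    (Bl M G 4 11 : ℚ) ≤ (0 : ℚ) * (Nl M G 11 : ℚ) := by
  have e_0_4 : Finset.Icc (0 : ℕ) 4 = {0, 1, 2, 3, 4} := by
    ext x; simp only [Finset.mem_Icc, Finset.mem_insert, Finset.mem_singleton]; omega
  have hr : ∀ f : ℕ → ℕ, ∑ l ∈ Finset.range (4 + 7 + 1), f l = f 0 + f 1 + f 2 + f 3 + f 4 + f 5 + f 6 + f 7 + f 8 + f 9 + f 10 + f 11 := by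
    intro f; simp only [Finset.sum_range_succ, Finset.sum_range_zero, Nat.zero_add]
  have chn_0 : Nat.choose (11 - 0) (4 - 2) = 55 := by decide
  have chn_1 : Nat.choose (11 - 1) (4 - 2) = 45 := by decide
  have chn_2 : Nat.choose (11 - 2) (4 - 2) = 36 := by decide
  have chn_3 : Nat.choose (11 - 3) (4 - 2) = 28 := by decide
  have chn_4 : Nat.choose (11 - 4) (4 - 2) = 21 := by decide
  have chn_5 : Nat.choose (11 - 5) (4 - 2) = 15 := by decide
  have chn_6 : Nat.choose (11 - 6) (4 - 2) = 10 := by decide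
  have chn_7 : Nat.choose (11 - 7) (4 - 2) = 6 := by decide
  have chn_8 : Nat.choose (11 - 8) (4 - 2) = 3 := by decide
  have chn_9 : Nat.choose (11 - 9) (4 - 2) = 1 := by decide
  have chn_10 : Nat.choose (11 - 10) (4 - 2) = 0 := by decide
  have chn_11 : Nat.choose (11 - 11) (4 - 2) = 0 := by decide
  have cl_0 : ∑ j ∈ Finset.Icc 3 (0 - 2), Nat.choose 0 j = 0 := by decide
  have cl_1 : ∑ j ∈ Finset.Icc 3 (1 - 2), Nat.choose 1 j = 0 := by decide
  have cl_2 : ∑ j ∈ Finset.Icc 3 (2 - 2), Nat.choose 2 j = 0 := by decide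
  have cl_3 : ∑ j ∈ Finset.Icc 3 (3 - 2), Nat.choose 3 j = 0 := by decide
  have cl_4 : ∑ j ∈ Finset.Icc 3 (4 - 2), Nat.choose 4 j = 0 := by decide
  have cl_5 : ∑ j ∈ Finset.Icc 3 (5 - 2), Nat.choose 5 j = 10 := by decide
  have cl_6 : ∑ j ∈ Finset.Icc 3 (6 - 2), Nat.choose 6 j = 35 := by decide
  have cl_7 : ∑ j ∈ Finset.Icc 3 (7 - 2), Nat.choose 7 j = 91 := by decide
  have cl_8 : ∑ j ∈ Finset.Icc 3 (8 - 2), Nat.choose 8 j = 210 := by decide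
  have cl_9 : ∑ j ∈ Finset.Icc 3 (9 - 2), Nat.choose 9 j = 456 := by decide
  have cl_10 : ∑ j ∈ Finset.Icc 3 (10 - 2), Nat.choose 10 j = 957 := by decide
  have cl_11 : ∑ j ∈ Finset.Icc 3 (11 - 2), Nat.choose 11 j = 1969 := by decide
  refine ⟨?_, ?_, ?_, ?_, ?_, ?_, ?_, ?_, ?_, ?_, ?_, ?_, ?_, ?_, ?_, ?_, ?_, ?_, ?_, ?_, ?_, ?_⟩
  · have h : (Pc M G 4 0 0).card = 1 := by rw [card_Pc_zero hrG, hmG]; norm_num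
    exact_mod_cast h
  · have h : (Pc M G 4 0 1).card = 0 := by rw [card_Pc_zero hrG, hmG]; norm_num
    exact_mod_cast h
  · have h : (Pc M G 4 0 2).card = 0 := by rw [card_Pc_zero hrG, hmG]; norm_num
    exact_mod_cast h
  · have h : (Pc M G 4 0 3).card = 0 := by rw [card_Pc_zero hrG, hmG]; norm_num
    exact_mod_cast h
  · have h : (Pc M G 4 0 4).card = 0 := by rw [card_Pc_zero hrG, hmG]; norm_num
    exact_mod_cast h
  · have h := card_Pc_eq_zero_of_basis hcard (q := 4) (M := M) (G := G) (m := 0) (by norm_num); exact_mod_cast h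
  · have h := card_Pc_eq_zero_of_basis hcard (q := 4) (M := M) (G := G) (m := 1) (by norm_num); exact_mod_cast h
  · have h := card_Pc_eq_zero_of_basis hcard (q := 4) (M := M) (G := G) (m := 2) (by norm_num); exact_mod_cast h
  · have h := card_Pc_eq_zero_of_basis hcard (q := 4) (M := M) (G := G) (m := 3) (by norm_num); exact_mod_cast h
  · have hsN : ∀ f : ℕ → ℕ, ∑ m ∈ Finset.Icc (0 : ℕ) 4, f m = f 0 + f 1 + f 2 + f 3 + f 4 := by
      intro f; rw [e_0_4, Finset.sum_insert (by simp), Finset.sum_insert (by simp), Finset.sum_insert (by simp), Finset.sum_insert (by simp), Finset.sum_singleton]; ring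
    have h1 := card_le_two_add_lines_le_DFq hs hG hrG (q := 4); rw [sum_card_lineSub_eq, hcard, hr] at h1; simp only [cl_0, cl_1, cl_2, cl_3, cl_4, cl_5, cl_6, cl_7, cl_8, cl_9, cl_10, cl_11] at h1
    have h2 := card_level_eq_sum_card_Pc hG hrG (q := 4) 0; have h3 := card_level_eq_sum_card_Pc hG hrG (q := 4) 1; have h4 := card_level_eq_sum_card_Pc hG hrG (q := 4) 2
    rw [hmG, hsN] at h2 h3 h4
    have h5 := card_three_le_card_filter_le_two (M := M) G 4
    have h6 : (Pc M G 4 0 0).card + (Pc M G 4 0 1).card + (Pc M G 4 0 2).card + (Pc M G 4 0 3).card + (Pc M G 4 0 4).card + (Pc M G 4 1 0).card + (Pc M G 4 1 1).card + (Pc M G 4 1 2).card + (Pc M G 4 1 3).card + (Pc M G 4 1 4).card + (Pc M G 4 2 0).card + (Pc M G 4 2 1).card + (Pc M G 4 2 2).card + (Pc M G 4 2 3).card + (Pc M G 4 2 4).card + 10 * Nl M G 5 + 35 * Nl M G 6 + 91 * Nl M G 7 + 210 * Nl M G 8 + 456 * Nl M G 9 + 957 * Nl M G 10 + 1969 * Nl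 M G 11 ≤ DFq M G 4 3 := by omega
    exact_mod_cast h6
  · have h := Bl_le (M := M) G 4 0; rw [hcard] at h; simp only [Nat.reduceSub, Nat.reduceAdd, chn_0] at h; have hq := (Nat.cast_le (α := ℚ)).mpr h; push_cast at hq; linear_combination hq
  · have h := Bl_le (M := M) G 4 1; rw [hcard] at h; simp only [Nat.reduceSub, Nat.reduceAdd, chn_1] at h; have hq := (Nat.cast_le (α := ℚ)).mpr h; push_cast at hq; linear_combination hq
  · have h := Bl_le (M := M) G 4 2; rw [hcard] at h; simp only [Nat.reduceSub, Nat.reduceAdd, chn_2] at h; have hq := (Nat.cast_le (α := ℚ)).mpr h; push_cast at hq; linear_combination hq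
  · have h := Bl_le (M := M) G 4 3; rw [hcard] at h; simp only [Nat.reduceSub, Nat.reduceAdd, chn_3] at h; have hq := (Nat.cast_le (α := ℚ)).mpr h; push_cast at hq; linear_combination hq
  · have h := Bl_le (M := M) G 4 4; rw [hcard] at h; simp only [Nat.reduceSub, Nat.reduceAdd, chn_4] at h; have hq := (Nat.cast_le (α := ℚ)).mpr h; push_cast at hq; linear_combination hq
  · have h := Bl_le (M := M) G 4 5; rw [hcard] at h; simp only [Nat.reduceSub, Nat.reduceAdd, chn_5] at h; have hq := (Nat.cast_le (α := ℚ)).mpr h; push_cast at hq; linear_combination hq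
  · have h := Bl_le (M := M) G 4 6; rw [hcard] at h; simp only [Nat.reduceSub, Nat.reduceAdd, chn_6] at h; have hq := (Nat.cast_le (α := ℚ)).mpr h; push_cast at hq; linear_combination hq
  · have h := Bl_le (M := M) G 4 7; rw [hcard] at h; simp only [Nat.reduceSub, Nat.reduceAdd, chn_7] at h; have hq := (Nat.cast_le (α := ℚ)).mpr h; push_cast at hq; linear_combination hq
  · have h := Bl_le (M := M) G 4 8; rw [hcard] at h; simp only [Nat.reduceSub, Nat.reduceAdd, chn_8] at h; have hq := (Nat.cast_le (α := ℚ)).mpr h; push_cast at hq; linear_combination hq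
  · have h := Bl_le (M := M) G 4 9; rw [hcard] at h; simp only [Nat.reduceSub, Nat.reduceAdd, chn_9] at h; have hq := (Nat.cast_le (α := ℚ)).mpr h; push_cast at hq; linear_combination hq
  · have h := Bl_le (M := M) G 4 10; rw [hcard] at h; simp only [Nat.reduceSub, Nat.reduceAdd, chn_10] at h; have hq := (Nat.cast_le (α := ℚ)).mpr h; push_cast at hq; linear_combination hq
  · have h := Bl_le (M := M) G 4 11; rw [hcard] at h; simp only [Nat.reduceSub, Nat.reduceAdd, chn_11] at h; have hq := (Nat.cast_le (α := ℚ)).mpr h; push_cast at hq; linear_combination hq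

/-- The partial certificate of the top level: `0 ≤ R`. -/
theorem c7_q4_m0_cert_top (hs : Simple M) {G : Finset α} (hG : G ⊆ gr M) (hrG : M.eRk (G : Set α) = ((4 : ℕ) : ℕ∞)) (hcard : G.card = 4 + 7) (hmG : mTr M G = 0) : 0 ≤ (49560 / 47 : ℚ) * ((Pc M G 4 0 0).card : ℚ) + (89481 / 94 : ℚ) * ((Pc M G 4 0 1).card : ℚ) + (-648973 / 940 : ℚ) * ((Pc M G 4 0 2).card : ℚ) + (142521 / 188 : ℚ) * ((Pc M G 4 0 3).card : ℚ) + (31128 / 47 : ℚ) * ((Pc M G 4 0 4).card : ℚ) + (-6 : ℚ) * ((Pc M G 4 1 0).card : ℚ) + (-6 : ℚ) * ((Pc M G 4 1 1).card : ℚ) + (-6 : ℚ) * ((Pc M G 4 1 2).card : ℚ) + (-6 : ℚ) * ((Pc M G 4 1 3).card : ℚ) + (-6 : ℚ) * ((Pc M G 4 1 4).card : ℚ) + (-6 : ℚ) * ((Pc M G 4 2 0).card : ℚ) + (-6 : ℚ) * ((Pc M G 4 2 1).card : ℚ) + (-6 : ℚ) * ((Pc M G 4 2 2).card : ℚ) +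 (-6 : ℚ) * ((Pc M G 4 2 3).card : ℚ) + (-6 : ℚ) * ((Pc M G 4 2 4).card : ℚ) + (6 : ℚ) * (DFq M G 4 3 : ℚ) + (-2368 / 1645 : ℚ) * (Bl M G 4 6 : ℚ) + (-91 : ℚ) * (Bl M G 4 7 : ℚ) + (-420 : ℚ) * (Bl M G 4 8 : ℚ) + (12 : ℚ) * ((Pc M G 4 7 0).card : ℚ) + (9 / 2 : ℚ) * ((Pc M G 4 7 1).card : ℚ) + (2 : ℚ) * ((Pc M G 4 7 2).card : ℚ) + (3 / 4 : ℚ) * ((Pc M G 4 7 3).card : ℚ) + (1140 / 329 : ℚ) * (Bl M G 4 3 : ℚ) + (28323 / 2632 : ℚ) * (Bl M G 4 4 : ℚ) + (155467 / 9870 : ℚ) * (Bl M G 4 5 : ℚ) + (68482401 / 6580 : ℚ) * (Bl M G 4 10 : ℚ) + (231127193 / 3290 : ℚ) * (Bl M G 4 11 : ℚ) + (-49842 / 47 : ℚ) := by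
  have htop := c7_q4_m0_top hs hG hrG hcard hmG
  linear_combination (6 : ℚ) * htop.2.2.2.2.2.2.2.2.2.1 + (2368 / 1645 : ℚ) * htop.2.2.2.2.2.2.2.2.2.2.2.2.2.2.2.2.1 + (91 : ℚ) * htop.2.2.2.2.2.2.2.2.2.2.2.2.2.2.2.2.2.1 + (420 : ℚ) * htop.2.2.2.2.2.2.2.2.2.2.2.2.2.2.2.2.2.2.1 + (-49842 / 47 : ℚ) * htop.1 + (-90045 / 94 : ℚ) * htop.2.1 + (643333 / 940 : ℚ) * htop.2.2.1 + (-143649 / 188 : ℚ) * htop.2.2.2.1 + (-31410 / 47 : ℚ) * htop.2.2.2.2.1 + (-12 : ℚ) * htop.2.2.2.2.2.1 + (-9 / 2 : ℚ) * htop.2.2.2.2.2.2.1 + (-2 : ℚ) * htop.2.2.2.2.2.2.2.1 + (-3 / 4 : ℚ) * htop.2.2.2.2.2.2.2.2.1 + (1140 / 329 : ℚ) * (Nat.cast_nonneg _ : (0 : ℚ) ≤ (Bl M G 4 3 : ℚ)) + (28323 / 2632 : ℚ) * (Nat.cast_nonneg _ : (0 : ℚ) ≤ (Bl M G 4 4 :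 ℚ)) + (155467 / 9870 : ℚ) * (Nat.cast_nonneg _ : (0 : ℚ) ≤ (Bl M G 4 5 : ℚ)) + (60 : ℚ) * (Nat.cast_nonneg _ : (0 : ℚ) ≤ (Nl M G 5 : ℚ)) + (64354 / 329 : ℚ) * (Nat.cast_nonneg _ : (0 : ℚ) ≤ (Nl M G 6 : ℚ)) + (2736 : ℚ) * (Nat.cast_nonneg _ : (0 : ℚ) ≤ (Nl M G 9 : ℚ)) + (68482401 / 6580 : ℚ) * (Nat.cast_nonneg _ : (0 : ℚ) ≤ (Bl M G 4 10 : ℚ)) + (5742 : ℚ) * (Nat.cast_nonneg _ : (0 : ℚ) ≤ (Nl M G 10 : ℚ)) + (231127193 / 3290 : ℚ) * (Nat.cast_nonneg _ : (0 : ℚ) ≤ (Bl M G 4 11 : ℚ)) + (11814 : ℚ) * (Nat.cast_nonneg _ : (0 : ℚ) ≤ (Nl M G 11 : ℚ))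

end PercRepro.Star
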